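/-
Copyright: the b2b-balaban T⁴-continuum CRUX team, row NE7b OWNER lineage `t4-ne7b-p1` (gen 142). Project licence.
-/
import Summits.QuantumFields.BalabanUV.T4Continuum.Spine.NE7b.SupDobrushinGroupCovariance

/-!
# DOBRUSHIN ACROSS A CUT AT ORDER FIVE: THE CLAMPED `1|4` AND `2|3` COVARIANCES (SCOPING (d14)(2)(ii), second analytic order-five file — the
# order-5 analogue of (489)).  For the cuts of five class observables clamp EVERY factor at level `R` (`T_Ru = max(−R, min(R,u))`, centring
# constants `m_i` arbitrary): the clamped quadruple product `T_Rf₂·T_Rf₃·T_Rf₄·T_Rf₅` is in the coordinate-Lipschitz class with vector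
# `R³(a₂+a₃+a₄+a₅)` (§1, from (489)'s triple), the clamped single `T_Rf₁` has vector `a₁` ((461)), the clamped pair `R(a₁+a₂)` ((461)) and the
# clamped triple `R²(a₃+a₄+a₅)` ((489)); so (447) gives
#   `1|4`:  `|Cov_ν(T_Rf₁, T_Rf₂T_Rf₃T_Rf₄T_Rf₅)| ≤ R³·Σ_w(Dᵀa₁)_w(Dᵀ(a₂+a₃+a₄+a₅))_w∕c_w`,
#   `2|3`:  `|Cov_ν(T_Rf₁T_Rf₂, T_Rf₃T_Rf₄T_Rf₅)| ≤ R³·Σ_w(Dᵀ(a₁+a₂))_w(Dᵀ(a₃+a₄+a₅))_w∕c_w`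
# — each bilinear form expands into the crossing pairings `B(a_i,a_j)`, which decay across the cut ((466)).  With (541)'s five-factor defect
# `Σm₆∕R`, its re-centring cost `m₂∕R` and (486)∕(490)'s pair∕triple defects these are the two generic cut bounds of the fifth cumulant (next
# file) (row NE7b, node U5c; (447) `abs_cov_le_kernel_gibbs`, (461) `clamp_centred_lipVec`∕`clamped_prod_lipVec`, (489) `clamped_triple_lipVec`
# BY NAME; [folklore])

Cell `pub-balaban`, sub-cell `t4`, spine estimate NE7b (`T4WeightBudget.RelWeightBound`; the cell's OWN estimate — NOT PRINTED in
[Bałaban 1983–89], NOT PROVED).  Crux-route work under `Spine/NE7b/` by the row OWNER (`t4-ne7b-p1` gen 142, file (542)) under FREEZE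
(0)'s crux-prover clause; NOTHING of Bałaban's is named as a Lean object, valued or asserted; no `T4Continuum/Support` leaf typed; no
`def`, no notation; zero `sorry`.  Imports (BY NAME): the OWNER's (489) `…SupDobrushinGroupCovariance` (`clamped_triple_lipVec`; through it (461)
`clamp_centred_lipVec`, `clamped_prod_lipVec`, (447) `abs_cov_le_kernel_gibbs`, (445) `SupCoordinateLipschitzClass.lipVec_nonneg`).

WHAT IS PROVED ([folklore]): §1 `clamped_quad_lipVec`; §2 **`clamped_single_quad_cov_le`** (cut `1|4`), **`clamped_pair_triple_cov_le`** (cut `2|3`);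
§3 toy.

HONEST (what this is NOT).  The Dobrushin side of the two order-five cut shapes only; the truncation defects are (541)∕(486)∕(490), the assembled
cut bounds with the power bookkeeping, the fifteen instantiations feeding (539)∕(537), the whitened instantiation and the fifth cumulant's kernel
letter are the next files; scalar skeleton ((A3), NC-NE7b-α UNRULED); nothing of Bałaban's asserted.  BY-NAME EFFECT ON THE WALL: NONE.  NE7b NOT
PRINTED ∕ NOT PROVED; spine PROVED 0∕9; rung (B)+1 — FINITE-torus statements; NOT the mass gap, NOT Clay.  HONEST DEPENDENCY: continuum YM on T⁴
⇐ BetaPertH ∧ nine spine estimates (0∕9 proved); BetaPertH ⇐ (D1) ∧ (D4) ∧ CAP+tail; G-an2-4 gates asym, D1 and NE2∕3∕4.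
-/

set_option autoImplicit false

noncomputable section

namespace Summit.QuantumFields.BalabanUV.T4Continuum.NE7b.SupDobrushinGroupCovarianceFive

open MeasureTheory Real Set Function Finset
open scoped BigOperators
open SupDobrushinCovarianceGibbs (abs_cov_le_kernel_gibbs)
open SupDobrushinThirdCumulant (clamp_centred_lipVec clamped_prod_lipVec)
open SupDobrushinGroupCovariance (clamped_triple_lipVec)

variable {ι : Type} [Fintype ι] [DecidableEq ι]

variable {V : (ι → ℝ) → ℝ} {V₁ : ι → (ι → ℝ) → ℝ} {c : ι → ℝ} {Cw γ : ℝ} {J D : ι → ι → ℝ}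
  {P : ι → ((ι → ℝ) → ℝ) → ((ι → ℝ) → ℝ)} {F₁ F₂ F₃ F₄ F₅ : (ι → ℝ) → ℝ} {a₁ a₂ a₃ a₄ a₅ : ι → ℝ}

/-! ## §1. The clamped quadruple product -/

omit [Fintype ι] in
/-- **The quadruple clamped product `T_R(F₂−m₂)·T_R(F₃−m₃)·T_R(F₄−m₄)·T_R(F₅−m₅)` has vector `R³(a₂+a₃+a₄+a₅)`**. [folklore] -/
theorem clamped_quad_lipVec (h2 : ∀ z ω s t, |F₂ (update ω z s) - F₂ (update ω z t)| ≤ a₂ z * |s - t|)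
    (h3 : ∀ z ω s t, |F₃ (update ω z s) - F₃ (update ω z t)| ≤ a₃ z * |s - t|)
    (h4 : ∀ z ω s t, |F₄ (update ω z s) - F₄ (update ω z t)| ≤ a₄ z * |s - t|)
    (h5 : ∀ z ω s t, |F₅ (update ω z s) - F₅ (update ω z t)| ≤ a₅ z * |s - t|) (m₂ m₃ m₄ m₅ : ℝ) {R : ℝ} (hR : 0 ≤ R) (z : ι)
    (ω : ι → ℝ) (s t : ℝ) :
    |max (-R) (min R (F₂ (update ω z s) - m₂)) * max (-R) (min R (F₃ (update ω z s) - m₃)) * max (-R) (min R (F₄ (update ω z s) - m₄)) *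
          max (-R) (min R (F₅ (update ω z s) - m₅)) -
        max (-R) (min R (F₂ (update ω z t) - m₂)) * max (-R) (min R (F₃ (update ω z t) - m₃)) * max (-R) (min R (F₄ (update ω z t) - m₄)) *
          max (-R) (min R (F₅ (update ω z t) - m₅))| ≤
      (R ^ 3 * (a₂ z + a₃ z + a₄ z + a₅ z)) * |s - t| := by
  set x := max (-R) (min R (F₂ (update ω z s) - m₂)) * max (-R) (min R (F₃ (update ω z s) - m₃)) * max (-R) (min R (F₄ (update ω z s) - m₄))
  set x' := max (-R) (min R (F₂ (update ω z t) - m₂)) * max (-R) (min R (F₃ (update ω z t) - m₃)) * max (-R) (min R (F₄ (update ω z t) - m₄))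
  set y := max (-R) (min R (F₅ (update ω z s) - m₅))
  set y' := max (-R) (min R (F₅ (update ω z t) - m₅))
  have hTR : ∀ u : ℝ, |max (-R) (min R u)| ≤ R := fun u => abs_le.2 ⟨le_max_left _ _, max_le (by linarith) (min_le_left _ _)⟩
  have hx : |x| ≤ R * R * R := by
    rw [abs_mul, abs_mul]
    exact mul_le_mul (mul_le_mul (hTR _) (hTR _) (abs_nonneg _) hR) (hTR _) (abs_nonneg _) (mul_nonneg hR hR)
  have hxx' : |x - x'| ≤ (R ^ 2 * (a₂ z + a₃ z + a₄ z)) * |s - t| := clamped_triple_lipVec h2 h3 h4 m₂ m₃ m₄ hR z ω s t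
  have hyy' : |y - y'| ≤ a₅ z * |s - t| := clamp_centred_lipVec h5 m₅ R z ω s t
  have e : x * y - x' * y' = x * (y - y') + (x - x') * y' := by ring
  rw [e]
  refine (abs_add_le _ _).trans ?_
  rw [abs_mul x (y - y'), abs_mul (x - x') y']
  have ha₂ := SupCoordinateLipschitzClass.lipVec_nonneg h2 z
  have ha₃ := SupCoordinateLipschitzClass.lipVec_nonneg h3 z
  have ha₄ := SupCoordinateLipschitzClass.lipVec_nonneg h4 z
  have h1 : |x| * |y - y'| ≤ (R * R * R) * (a₅ z * |s - t|) := mul_le_mul hx hyy' (abs_nonneg _) (mul_nonneg (mul_nonneg hR hR) hR)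
  have h2' : |x - x'| * |y'| ≤ ((R ^ 2 * (a₂ z + a₃ z + a₄ z)) * |s - t|) * R :=
    mul_le_mul hxx' (hTR _) (abs_nonneg _) (mul_nonneg (mul_nonneg (sq_nonneg _) (add_nonneg (add_nonneg ha₂ ha₃) ha₄)) (abs_nonneg _))
  calc |x| * |y - y'| + |x - x'| * |y'| ≤ (R * R * R) * (a₅ z * |s - t|) + ((R ^ 2 * (a₂ z + a₃ z + a₄ z)) * |s - t|) * R := add_le_add h1 h2'
    _ = (R ^ 3 * (a₂ z + a₃ z + a₄ z + a₅ z)) * |s - t| := by ring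

/-! ## §2. The two clamped covariances across a cut -/

/-- **DOBRUSHIN ACROSS THE CUT `{1}|{2,3,4,5}`**:
`|Cov_ν(T_Rf₁, T_Rf₂T_Rf₃T_Rf₄T_Rf₅)| ≤ R³·Σ_w(Dᵀa₁)_w((Dᵀa₂)_w + (Dᵀa₃)_w + (Dᵀa₄)_w + (Dᵀa₅)_w)∕c_w`. [folklore] -/
theorem clamped_single_quad_cov_le
    (hP : ∀ x F ω, P x F ω = (∫ s, F (update ω x s) * exp (-V (update ω x s))) / ∫ s, exp (-V (update ω x s)))
    (hV : ∀ x ω, HasDerivAt (fun s => V (update ω x s)) (V₁ x ω) (ω x))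
    (hfloor : ∀ x ω s t, c x * (s - t) ^ 2 ≤ (V₁ x (update ω x s) - V₁ x (update ω x t)) * (s - t)) (hc : ∀ x, 0 < c x)
    (hceil : ∀ x ω s t, |V₁ x (update ω x s) - V₁ x (update ω x t)| ≤ Cw * |s - t|)
    (hcross : ∀ x z, z ≠ x → ∀ ω s t, |V₁ x (update ω z s) - V₁ x (update ω z t)| ≤ J x z * |s - t|) (hVc : Continuous V)
    (hV0 : Integrable (fun ω : ι → ℝ => exp (-V ω))) (hV2 : ∀ z, Integrable (fun ω : ι → ℝ => ω z ^ 2 * exp (-V ω)))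
    (hJ : ∀ x z, 0 ≤ J x z) (hJ0 : ∀ x, J x x = 0) (hrow : ∀ x, ∑ z, J x z / c x ≤ γ) (hγ0 : 0 ≤ γ) (hγ1 : γ < 1)
    (hD : ∀ x y, 0 ≤ D x y) (hDC : ∀ x y, (if x = y then (1 : ℝ) else 0) + ∑ z, D x z * (J z y / c z) ≤ D x y)
    (h1 : ∀ z ω s t, |F₁ (update ω z s) - F₁ (update ω z t)| ≤ a₁ z * |s - t|)
    (h2 : ∀ z ω s t, |F₂ (update ω z s) - F₂ (update ω z t)| ≤ a₂ z * |s - t|)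
    (h3 : ∀ z ω s t, |F₃ (update ω z s) - F₃ (update ω z t)| ≤ a₃ z * |s - t|)
    (h4 : ∀ z ω s t, |F₄ (update ω z s) - F₄ (update ω z t)| ≤ a₄ z * |s - t|)
    (h5 : ∀ z ω s t, |F₅ (update ω z s) - F₅ (update ω z t)| ≤ a₅ z * |s - t|) (m₁ m₂ m₃ m₄ m₅ : ℝ) {R : ℝ} (hR : 0 ≤ R) :
    |(∫ ω, max (-R) (min R (F₁ ω - m₁)) * (max (-R) (min R (F₂ ω - m₂)) * max (-R) (min R (F₃ ω - m₃)) * max (-R) (min R (F₄ ω - m₄)) *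
            max (-R) (min R (F₅ ω - m₅))) ∂((volume : Measure (ι → ℝ)).tilted fun ω => -V ω)) -
        (∫ ω, max (-R) (min R (F₁ ω - m₁)) ∂((volume : Measure (ι → ℝ)).tilted fun ω => -V ω)) *
          (∫ ω, max (-R) (min R (F₂ ω - m₂)) * max (-R) (min R (F₃ ω - m₃)) * max (-R) (min R (F₄ ω - m₄)) * max (-R) (min R (F₅ ω - m₅))
            ∂((volume : Measure (ι → ℝ)).tilted fun ω => -V ω))| ≤
      R ^ 3 * ∑ w, (∑ z, D z w * a₁ z) * ((∑ z, D z w * a₂ z) + (∑ z, D z w * a₃ z) + (∑ z, D z w * a₄ z) + ∑ z, D z w * a₅ z) / c w := by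
  have hX := clamp_centred_lipVec h1 m₁ R
  have hY := clamped_quad_lipVec h2 h3 h4 h5 m₂ m₃ m₄ m₅ hR
  have h447 := abs_cov_le_kernel_gibbs (F := fun ω => max (-R) (min R (F₁ ω - m₁)))
    (G := fun ω => max (-R) (min R (F₂ ω - m₂)) * max (-R) (min R (F₃ ω - m₃)) * max (-R) (min R (F₄ ω - m₄)) * max (-R) (min R (F₅ ω - m₅)))
    (a := a₁) (b := fun z => R ^ 3 * (a₂ z + a₃ z + a₄ z + a₅ z)) hP hV hfloor hc hceil hcross hVc hV0 hV2 hJ hJ0 hrow hγ0 hγ1 hD hDC hX hY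
  refine h447.trans (le_of_eq ?_)
  rw [Finset.mul_sum]
  refine Finset.sum_congr rfl fun w _ => ?_
  have e2 : ∑ z, D z w * (R ^ 3 * (a₂ z + a₃ z + a₄ z + a₅ z)) =
      R ^ 3 * ((∑ z, D z w * a₂ z) + (∑ z, D z w * a₃ z) + (∑ z, D z w * a₄ z) + ∑ z, D z w * a₅ z) := by
    rw [← Finset.sum_add_distrib, ← Finset.sum_add_distrib, ← Finset.sum_add_distrib, Finset.mul_sum]
    exact Finset.sum_congr rfl fun z _ => by ring
  rw [e2]
  ring

/-- **DOBRUSHIN ACROSS THE CUT `{1,2}|{3,4,5}`**: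
`|Cov_ν(T_Rf₁T_Rf₂, T_Rf₃T_Rf₄T_Rf₅)| ≤ R³·Σ_w((Dᵀa₁)_w + (Dᵀa₂)_w)((Dᵀa₃)_w + (Dᵀa₄)_w + (Dᵀa₅)_w)∕c_w`. [folklore] -/
theorem clamped_pair_triple_cov_le
    (hP : ∀ x F ω, P x F ω = (∫ s, F (update ω x s) * exp (-V (update ω x s))) / ∫ s, exp (-V (update ω x s)))
    (hV : ∀ x ω, HasDerivAt (fun s => V (update ω x s)) (V₁ x ω) (ω x))
    (hfloor : ∀ x ω s t, c x * (s - t) ^ 2 ≤ (V₁ x (update ω x s) - V₁ x (update ω x t)) * (s - t)) (hc : ∀ x, 0 < c x)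
    (hceil : ∀ x ω s t, |V₁ x (update ω x s) - V₁ x (update ω x t)| ≤ Cw * |s - t|)
    (hcross : ∀ x z, z ≠ x → ∀ ω s t, |V₁ x (update ω z s) - V₁ x (update ω z t)| ≤ J x z * |s - t|) (hVc : Continuous V)
    (hV0 : Integrable (fun ω : ι → ℝ => exp (-V ω))) (hV2 : ∀ z, Integrable (fun ω : ι → ℝ => ω z ^ 2 * exp (-V ω)))
    (hJ : ∀ x z, 0 ≤ J x z) (hJ0 : ∀ x, J x x = 0) (hrow : ∀ x, ∑ z, J x z / c x ≤ γ) (hγ0 : 0 ≤ γ) (hγ1 : γ < 1)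
    (hD : ∀ x y, 0 ≤ D x y) (hDC : ∀ x y, (if x = y then (1 : ℝ) else 0) + ∑ z, D x z * (J z y / c z) ≤ D x y)
    (h1 : ∀ z ω s t, |F₁ (update ω z s) - F₁ (update ω z t)| ≤ a₁ z * |s - t|)
    (h2 : ∀ z ω s t, |F₂ (update ω z s) - F₂ (update ω z t)| ≤ a₂ z * |s - t|)
    (h3 : ∀ z ω s t, |F₃ (update ω z s) - F₃ (update ω z t)| ≤ a₃ z * |s - t|)
    (h4 : ∀ z ω s t, |F₄ (update ω z s) - F₄ (update ω z t)| ≤ a₄ z * |s - t|)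
    (h5 : ∀ z ω s t, |F₅ (update ω z s) - F₅ (update ω z t)| ≤ a₅ z * |s - t|) (m₁ m₂ m₃ m₄ m₅ : ℝ) {R : ℝ} (hR : 0 ≤ R) :
    |(∫ ω, (max (-R) (min R (F₁ ω - m₁)) * max (-R) (min R (F₂ ω - m₂))) *
            (max (-R) (min R (F₃ ω - m₃)) * max (-R) (min R (F₄ ω - m₄)) * max (-R) (min R (F₅ ω - m₅)))
          ∂((volume : Measure (ι → ℝ)).tilted fun ω => -V ω)) -
        (∫ ω, max (-R) (min R (F₁ ω - m₁)) * max (-R) (min R (F₂ ω - m₂)) ∂((volume : Measure (ι → ℝ)).tilted fun ω => -V ω)) *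
          (∫ ω, max (-R) (min R (F₃ ω - m₃)) * max (-R) (min R (F₄ ω - m₄)) * max (-R) (min R (F₅ ω - m₅))
            ∂((volume : Measure (ι → ℝ)).tilted fun ω => -V ω))| ≤
      R ^ 3 * ∑ w, ((∑ z, D z w * a₁ z) + ∑ z, D z w * a₂ z) * ((∑ z, D z w * a₃ z) + (∑ z, D z w * a₄ z) + ∑ z, D z w * a₅ z) / c w := by
  have hX := clamped_prod_lipVec h1 h2 m₁ m₂ hR
  have hY := clamped_triple_lipVec h3 h4 h5 m₃ m₄ m₅ hR
  have h447 := abs_cov_le_kernel_gibbs (F := fun ω => max (-R) (min R (F₁ ω - m₁)) * max (-R) (min R (F₂ ω - m₂)))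
    (G := fun ω => max (-R) (min R (F₃ ω - m₃)) * max (-R) (min R (F₄ ω - m₄)) * max (-R) (min R (F₅ ω - m₅)))
    (a := fun z => R * (a₁ z + a₂ z)) (b := fun z => R ^ 2 * (a₃ z + a₄ z + a₅ z)) hP hV hfloor hc hceil hcross hVc hV0 hV2 hJ hJ0 hrow hγ0 hγ1
    hD hDC hX hY
  refine h447.trans (le_of_eq ?_)
  rw [Finset.mul_sum]
  refine Finset.sum_congr rfl fun w _ => ?_
  have e1 : ∑ z, D z w * (R * (a₁ z + a₂ z)) = R * ((∑ z, D z w * a₁ z) + ∑ z, D z w * a₂ z) := by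
    rw [← Finset.sum_add_distrib, Finset.mul_sum]
    exact Finset.sum_congr rfl fun z _ => by ring
  have e2 : ∑ z, D z w * (R ^ 2 * (a₃ z + a₄ z + a₅ z)) = R ^ 2 * ((∑ z, D z w * a₃ z) + (∑ z, D z w * a₄ z) + ∑ z, D z w * a₅ z) := by
    rw [← Finset.sum_add_distrib, ← Finset.sum_add_distrib, Finset.mul_sum]
    exact Finset.sum_congr rfl fun z _ => by ring
  rw [e1, e2]
  ring

/-! ## §3. Toy -/

/-- Toy (§1 with all vectors zero: a constant clamped quadruple product does not move). -/
example (R s t : ℝ) : (R ^ 3 * (0 + 0 + 0 + 0)) * |s - t| = 0 := by ring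

end Summit.QuantumFields.BalabanUV.T4Continuum.NE7b.SupDobrushinGroupCovarianceFive

end
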